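import Summits.CriticalPhenomena.PercolationContinuityZ3.Theorems.PercNearOneGluingNoHeavyQuantFarSunTKGenSym
import Summits.CriticalPhenomena.PercolationContinuityZ3.Theorems.PercNearOneGluingNoHeavyQuantFarSunTKFinal
import HarnessLib

/-!
# FAR beyond trees: `HairyCycle.SunFAR K 1` for `K = 2` and `K = 3` WITHOUT `native_decide` — a tabulated law-level certificate

builds on p205010 (kernel theorem, internal audit signed; external expert review pending)

Support file (`--supports stmt-CriticalPhenomena-4575`), seat `prim-cert-1` (gen 23); memo `prim-cert-1/FROM-prim-cert-1-g23-SUNFAR-ALL-K.md` §9.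
The closed-form certificate `T_K` needs `K ≥ 4` (`…TKFinal`); gen 18 settled `K ≤ 7` by `native_decide` certificates.  Here the two
remaining small cases are done with standard axioms only:
* `K = 2` is vacuous (`Σ_k q_k ≤ 2`): `HairyCycle.sunFAR_one_two`.
* `K = 3`: the relay-set-level two-copy certificate `F₃(R;R') = Σ_i a_i(R')(𝟙[i ∉ R] − 𝟙[|R| ≤ 1]) − b(R')(|R| − 2)` with the
  integer tables `TK.a3tab`, `TK.b3tab` (found by an LP for the lead's law-level sufficient condition, kit job j154996; `Σ_i a_i(R') ≥ 3`)
  satisfies the CORE INEQUALITY of `…TKGenSym` — a finite check, `decide` in the kernel (`TK.core3_check`) — hence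
  `E_{μ⊗μ} W₃ ≥ 0` by the general law-level symmetrisation `TK.tcE2_nonneg_of_core` (`…TKGenSym`), and the certificate identity gives
  **`HairyCycle.sunFAR_one_three : SunFAR 3 1`**.
(`HairyCycle.sunFAR_one` in `…TKFinalAllK` then dispatches `K = 2`, `K = 3`, `K ≥ 4` — every `K ≥ 2` with standard axioms.)
No sorries; standard axioms (no `native_decide`).  [this work].
-/

namespace Summit.CriticalPhenomena.PercolationContinuityZ3.Theorems.HairyCycle

namespace TK

open Finset

/-! ## The `K = 3` certificate tables (computable) -/

/-- Multiplier table `a_i(R')` (integers) of the `K = 3` law-level certificate, indexed by `i` and the membership bits of `0, 1, 2`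
in `R'` (kit j154996, denominators cleared). [this work] -/
def a3tab : ℕ → Bool → Bool → Bool → ℤ
  | 0, true, true, false => 2
  | 0, false, false, true => 3
  | 0, true, false, true => 2
  | 1, false, false, false => 3
  | 1, true, false, false => 1
  | 1, false, true, false => 2
  | 1, true, true, false => 1
  | 1, true, true, true => 3
  | 2, true, false, false => 2
  | 2, false, true, false => 2
  | 2, true, false, true => 1
  | 2, false, true, true => 3
  | _, _, _, _ => 0

/-- Multiplier table `b(R')` of the `K = 3` certificate. [this work] -/
def b3tab : Bool → Bool → Bool → ℤ
  | false, true, false => 2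
  | true, false, true => 1
  | _, _, _ => 0

/-- `a_i(R')`, `K = 3`. [this work] -/
def a3 (i : ℕ) (R' : Finset ℕ) : ℤ := a3tab i (decide (0 ∈ R')) (decide (1 ∈ R')) (decide (2 ∈ R'))

/-- `b(R')`, `K = 3`. [this work] -/
def b3 (R' : Finset ℕ) : ℤ := b3tab (decide (0 ∈ R')) (decide (1 ∈ R')) (decide (2 ∈ R'))

/-- The pair function `F₃(R;R') = Σ_{i<3} a_i(R')·(𝟙[i ∉ R] − 𝟙[|R| ≤ 1]) − b(R')·(|R| − 2)`. [this work] -/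
def F3 (R R' : Finset ℕ) : ℤ :=
  (∑ k ∈ range 3, a3 k R' * ((if k ∉ R then 1 else 0) - (if R.card ≤ 1 then 1 else 0))) - b3 R' * ((R.card : ℤ) - 2)

/-- The symmetrised weight `W₃(R,R') = F₃(R;R') + F₃(R';R)`. [this work] -/
def W3 (R R' : Finset ℕ) : ℤ := F3 R R' + F3 R' R

/-- `W₃` is symmetric. [this work] -/
theorem W3_comm (V U : Finset ℕ) : W3 V U = W3 U V := by
  unfold W3; ring

/-- `a_i ≥ 0`. [this work] -/
theorem a3_nonneg (i : ℕ) (R' : Finset ℕ) : 0 ≤ a3 i R' := by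
  unfold a3
  generalize decide (0 ∈ R') = b0
  generalize decide (1 ∈ R') = b1
  generalize decide (2 ∈ R') = b2
  rcases i with _ | _ | _ | i
  · cases b0 <;> cases b1 <;> cases b2 <;> decide
  · cases b0 <;> cases b1 <;> cases b2 <;> decide
  · cases b0 <;> cases b1 <;> cases b2 <;> decide
  · cases b0 <;> cases b1 <;> cases b2 <;> simp [a3tab]

/-- `b ≥ 0`. [this work] -/
theorem b3_nonneg (R' : Finset ℕ) : 0 ≤ b3 R' := by
  unfold b3
  generalize decide (0 ∈ R') = b0
  generalize decide (1 ∈ R') = b1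
  generalize decide (2 ∈ R') = b2
  cases b0 <;> cases b1 <;> cases b2 <;> decide

/-- The normalisation `Σ_i a_i(R') ≥ 3` (every ghost outcome bets). [this work] -/
theorem three_le_sum_a3 (R' : Finset ℕ) : (3 : ℤ) ≤ ∑ k ∈ range 3, a3 k R' := by
  unfold a3
  simp only [Finset.sum_range_succ, Finset.sum_range_zero, zero_add]
  generalize decide (0 ∈ R') = b0
  generalize decide (1 ∈ R') = b1
  generalize decide (2 ∈ R') = b2
  cases b0 <;> cases b1 <;> cases b2 <;> decide

/-! ## The core inequality for `W₃`: a finite check -/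

set_option synthInstance.maxHeartbeats 400000 in
set_option synthInstance.maxSize 4096 in
set_option maxHeartbeats 40000000 in
/-- THE CHECK (kernel `decide`, standard axioms): the core inequality for `W₃` over all `l ≤ 4`, `m ≤ l`, `a ≤ b ≤ 3` and all disjoint
`Z, T ⊆ {0,1,2}`. [this work] -/
theorem core3_check : ∀ l < 5, ∀ m < 5, ∀ b < 4, ∀ a < 4, m ≤ l → a ≤ b →
    ∀ Z ∈ (range 3).powerset, ∀ T ∈ (range 3).powerset, Disjoint Z T →
      0 ≤ (∑ J ∈ T.powerset, W3 (cov 3 l a ∩ (Z ∪ J)) (cov 3 m b ∩ (Z ∪ (T \ J)))) +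
        ∑ J ∈ T.powerset, W3 (cov 3 l b ∩ (Z ∪ J)) (cov 3 m a ∩ (Z ∪ (T \ J))) := by
  decide +kernel

/-- The core inequality for `W₃` in the form used by `TK.tcE2_nonneg_of_core`. [this work] -/
theorem coreNonneg_W3 : ∀ l m a b : ℕ, m ≤ l → l ≤ 3 + 1 → a ≤ b → b ≤ 3 →
    ∀ Z T : Finset ℕ, Z ⊆ range 3 → T ⊆ range 3 → Disjoint Z T →
      0 ≤ (∑ J ∈ T.powerset, W3 (cov 3 l a ∩ (Z ∪ J)) (cov 3 m b ∩ (Z ∪ (T \ J)))) +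
        ∑ J ∈ T.powerset, W3 (cov 3 l b ∩ (Z ∪ J)) (cov 3 m a ∩ (Z ∪ (T \ J))) := by
  intro l m a b hml hl hab hb Z T hZ hT hZT
  exact core3_check l (by omega) m (by omega) b (by omega) a (by omega) hml hab Z (Finset.mem_powerset.2 hZ) T
    (Finset.mem_powerset.2 hT) hZT

/-! ## `SunFAR 3 1` -/

section Three

open scoped Classical

/-- `2 · E_{μ⊗μ} F₃ = E_{μ⊗μ} W₃`. [this work] -/
theorem two_mul_tcE2_F3 (g h : ℕ → ℝ) :
    2 * tcE2 3 g h (fun R R' => (F3 R R' : ℝ)) = tcE2 3 g h (fun R R' => (W3 R R' : ℝ)) := by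
  have hsw := tcE2_swap (K := 3) g h (fun R R' => (F3 R R' : ℝ))
  have hlin := tcE2_lin (K := 3) g h 1 1 (fun R R' => (F3 R R' : ℝ)) (fun R R' => (F3 R' R : ℝ))
  have hWdef : tcE2 3 g h (fun R R' => (W3 R R' : ℝ)) = tcE2 3 g h (fun R R' => 1 * (F3 R R' : ℝ) + 1 * (F3 R' R : ℝ)) := by
    congr 1; ext R R'; unfold W3; push_cast; ring
  rw [hWdef, hlin, hsw]
  ring

/-- **`SunFAR 3 1`** — FAR at layer one on the sun graph with three hairs, all weights; standard axioms (tabulated law-level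
certificate `F₃`, kernel-checked core inequality, law-level symmetrisation). [this work] -/
theorem sunFAR_one_three : SunFAR 3 1 := by
  intro g h hg hh hEN t ht
  have hK2 : 2 ≤ 3 := by norm_num
  set P1 : ℝ := sunLaw 3 g h (fun R => R.card ≤ 1) with hP1
  have eP1 : P1 = tcE 3 g h (fun R => if R.card ≤ 1 then 1 else 0) := by
    rw [hP1, sunLaw_eq_tcE]; exact tcE_congr fun R _ => by congr
  have eq_k : ∀ k, k < 3 → tcE 3 g h (fun R => if k ∉ R then (1 : ℝ) else 0) = 1 - sunMarg 3 g h k := by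
    intro k hk
    rw [← sunLaw_mem_eq_sunMarg hK2 hg hh hk, ← sunLaw_not hK2 hg hh, sunLaw_eq_tcE]
    exact tcE_congr fun R _ => by congr
  have eEN : tcE 3 g h (fun R => (R.card : ℝ)) = ∑ k ∈ range 3, sunMarg 3 g h k := by
    have e1 : tcE 3 g h (fun R => (R.card : ℝ)) = tcE 3 g h (fun R => ∑ k ∈ range 3, if k ∈ R then (1 : ℝ) else 0) := by
      refine tcE_congr fun R hR => ?_
      rw [Finset.sum_ite_mem, Finset.inter_eq_right.2 hR, Finset.sum_const, nsmul_eq_mul, mul_one]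
    rw [e1, tcE_sum]
    refine Finset.sum_congr rfl fun k hk => ?_
    rw [Finset.mem_range] at hk
    rw [← sunLaw_mem_eq_sunMarg hK2 hg hh hk, sunLaw_eq_tcE]
    exact tcE_congr fun R _ => by congr
  -- the certificate identity
  set abar : ℕ → ℝ := fun k => tcE 3 g h (fun R' => (a3 k R' : ℝ)) with habar
  set bbar : ℝ := tcE 3 g h (fun R' => (b3 R' : ℝ)) with hbbar
  have hF : tcE2 3 g h (fun R R' => (F3 R R' : ℝ)) =
      ∑ k ∈ range 3, (tcE 3 g h (fun R => if k ∉ R then (1 : ℝ) else 0) - P1) * abar k -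
        (tcE 3 g h (fun R => (R.card : ℝ)) - 2) * bbar := by
    have epoint : (fun R R' => (F3 R R' : ℝ)) = fun R R' =>
        1 * (∑ k ∈ range 3, (a3 k R' : ℝ) * ((if k ∉ R then (1 : ℝ) else 0) - (if R.card ≤ 1 then (1 : ℝ) else 0))) +
          (-1) * ((b3 R' : ℝ) * ((R.card : ℝ) - 2)) := by
      ext R R'; unfold F3; push_cast; ring
    have eA : ∀ k, tcE2 3 g h (fun R R' => (a3 k R' : ℝ) * ((if k ∉ R then (1 : ℝ) else 0) - (if R.card ≤ 1 then (1 : ℝ) else 0))) =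
        (tcE 3 g h (fun R => if k ∉ R then (1 : ℝ) else 0) - P1) * abar k := by
      intro k
      have e1 : (fun R R' : Finset ℕ => (a3 k R' : ℝ) * ((if k ∉ R then (1 : ℝ) else 0) - (if R.card ≤ 1 then (1 : ℝ) else 0))) =
          fun R R' => (1 * (if k ∉ R then (1 : ℝ) else 0) + (-1) * (if R.card ≤ 1 then (1 : ℝ) else 0)) * (a3 k R' : ℝ) := by
        ext R R'; ring
      rw [e1, tcE2_prod, tcE_lin, ← eP1]; ring
    have eB : tcE2 3 g h (fun R R' => (b3 R' : ℝ) * ((R.card : ℝ) - 2)) = (tcE 3 g h (fun R => (R.card : ℝ)) - 2) * bbar := by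
      have e1 : (fun R R' : Finset ℕ => (b3 R' : ℝ) * ((R.card : ℝ) - 2)) =
          fun R R' => (1 * (R.card : ℝ) + (-2) * (1 : ℝ)) * (b3 R' : ℝ) := by
        ext R R'; ring
      rw [e1, tcE2_prod, tcE_lin, tcE_const]; ring
    rw [epoint, tcE2_lin, tcE2_sum, eB]
    simp only [eA]
    ring
  -- signs
  have habar0 : ∀ k, 0 ≤ abar k := fun k => tcE_nonneg hg hh fun R' _ => by exact_mod_cast a3_nonneg k R'
  have hbbar0 : 0 ≤ bbar := tcE_nonneg hg hh fun R' _ => by exact_mod_cast b3_nonneg R'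
  have hq : ∀ k ∈ range 3, tcE 3 g h (fun R => if k ∉ R then (1 : ℝ) else 0) ≤ t := by
    intro k hk; rw [Finset.mem_range] at hk; rw [eq_k k hk]; exact ht k hk
  -- main inequality: Σ_k (q_k − P1)·ā_k ≥ (EN − 2)·b̄ ≥ 0
  have hmain : 0 ≤ ∑ k ∈ range 3, (tcE 3 g h (fun R => if k ∉ R then (1 : ℝ) else 0) - P1) * abar k := by
    have h1 : 0 ≤ tcE2 3 g h (fun R R' => (F3 R R' : ℝ)) := by
      have hW := tcE2_nonneg_of_core coreNonneg_W3 W3_comm hg hh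
      have h2 := two_mul_tcE2_F3 g h
      linarith
    rw [hF, eEN] at h1
    have h2 : 0 ≤ (∑ k ∈ range 3, sunMarg 3 g h k - 2) * bbar := mul_nonneg (by push_cast at hEN; linarith) hbbar0
    linarith
  have hsum : 0 ≤ ∑ k ∈ range 3, (t - P1) * abar k := by
    refine le_trans hmain (Finset.sum_le_sum fun k hk => ?_)
    exact mul_le_mul_of_nonneg_right (by linarith [hq k hk]) (habar0 k)
  rw [← Finset.mul_sum] at hsum
  -- `Σ_k ā_k ≥ 3 > 0`
  have hpos : 0 < ∑ k ∈ range 3, abar k := by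
    have e : ∑ k ∈ range 3, abar k = tcE 3 g h (fun R' => ∑ k ∈ range 3, (a3 k R' : ℝ)) := by
      rw [tcE_sum]
    have h3 : (3 : ℝ) ≤ tcE 3 g h (fun R' => ∑ k ∈ range 3, (a3 k R' : ℝ)) := by
      have := tcE_mono hg hh (f := fun _ => (3 : ℝ)) (f' := fun R' => ∑ k ∈ range 3, (a3 k R' : ℝ))
        (fun R' _ => by exact_mod_cast three_le_sum_a3 R')
      rwa [tcE_const] at this
    rw [e]; linarith
  refine le_of_not_gt fun hcon => ?_
  have : (t - P1) * ∑ k ∈ range 3, abar k < 0 := mul_neg_of_neg_of_pos (by linarith) hpos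
  linarith

end Three

end TK

/-- **`SunFAR 2 1`** — vacuous: with two hairs `Σ_k q_k ≤ 2`. [this work] -/
theorem sunFAR_one_two : SunFAR 2 1 := by
  intro g h hg hh hEN t _
  have hK2 : 2 ≤ 2 := le_rfl
  have hm : ∀ k, k < 2 → sunMarg 2 g h k ≤ 1 := fun k hk => by
    rw [← sunLaw_mem_eq_sunMarg hK2 hg hh hk]; exact sunLaw_le_one hK2 hg hh _
  have : ∑ k ∈ Finset.range 2, sunMarg 2 g h k ≤ 2 := by
    rw [Finset.sum_range_succ, Finset.sum_range_succ, Finset.sum_range_zero]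
    linarith [hm 0 (by norm_num), hm 1 (by norm_num)]
  push_cast at hEN
  linarith

/-- **`SunFAR 3 1`** (route vocabulary alias of `TK.sunFAR_one_three`). [this work] -/
theorem sunFAR_one_three : SunFAR 3 1 := TK.sunFAR_one_three

end Summit.CriticalPhenomena.PercolationContinuityZ3.Theorems.HairyCycle
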